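import Summits.CriticalPhenomena.Ising3DConformalLimit.Theorems.PerfectScreeningSubharmonicOffOriginShiftedAxisBalance
import Literature.Probability.LatticeModels.DirInvCorrLength
import HarnessLib

/-!
# Outward ratio monotonicity implies `SubharmonicOffOrigin` (census S1, typed)

Route `PerfectScreening`, crux r2 `SubharmonicOffOrigin` (stmt-CriticalPhenomena-1341).  The
crux-strategist's census (`Cruxes/SubharmonicOffOrigin/STRATEGY-CENSUS.md` §5 S1) records the
STRENGTHENING "ratio monotonicity": the neighbour-sum ratio
`R(x) := ∑_{y∼x} G(y) / G(x)`, `G = criticalTwoPoint 3`, is non-increasing under every outward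
axis-parallel move; numerically plausible (`R(e₁) − 6 = 0.0416 > R(110) − 6 = 0.022 > …`) and
thinner than SubH (it is a statement about third log-differences).  This file proves the
implication `S1 ⇒ SubH` in the weakest form that suffices: monotonicity under the single move
`x ↦ x + e₀` on the half-space `x₀ ≥ 0` already gives the crux, because along every line parallel
to the first axis the ratio tends to `6` UNCONDITIONALLY (exact balance,
`AxisBalance.tendsto_nbrSum_div_shiftedAxis`, landed by lead c1) and a non-increasing sequence
dominates its limit; the half-space `x₀ < 0` is reached by the coordinate reflection `x₀ ↦ −x₀`,
a symmetry of `G` (`twoPointPlus_reflection_invariant_holds`) that preserves the neighbour sum.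

* `nbrSum_reflect`, `criticalTwoPoint_reflect` — invariance under `x₀ ↦ −x₀`;
* `subharmonicOffOrigin_of_ratioAntitone` — the implication (registered one-line form
  `subharmonicOffOrigin_of_ratioAntitone'`).

For refuters: a Monte-Carlo violation of outward ratio monotonicity does NOT refute the crux; a
proof of it would.  It proves nothing about the two-point function itself.
-/

noncomputable section

open Filter Topology Finset

namespace Summit.CriticalPhenomena.Ising3DConformalLimit.Theorems.PerfectScreening.RatioMonotone

open Literature.Probability.LatticeModels
open Summit.CriticalPhenomena.Ising3DConformalLimit.Theses.PerfectScreening (SubharmonicOffOrigin)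
open Summit.CriticalPhenomena.Ising3DConformalLimit.Theorems.PerfectScreening.AxisBalance

/-! ### The coordinate reflection `x₀ ↦ −x₀` -/

/-- `G` is invariant under the reflection of the first coordinate. [cite: FriedliVelenik2017, Exercise 3.14, p. 115] -/
theorem criticalTwoPoint_reflect (x : Site 3) :
    criticalTwoPoint 3 (Function.update x 0 (-x 0)) = criticalTwoPoint 3 x :=
  twoPointPlus_reflection_invariant_holds (criticalBeta_nonneg 3) 0 x

/-- Reflection and the unit steps: `r(x) + e₀ = r(x − e₀)`. [folklore] -/
theorem reflect_add_single_zero (x : Site 3) :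
    Function.update x 0 (-x 0) + Pi.single 0 1 =
      Function.update (x - Pi.single 0 1) 0 (-(x - Pi.single 0 1 : Site 3) 0) := by
  funext i
  fin_cases i <;> simp
  ring

/-- Reflection and the unit steps: `r(x) − e₀ = r(x + e₀)`. [folklore] -/
theorem reflect_sub_single_zero (x : Site 3) :
    Function.update x 0 (-x 0) - Pi.single 0 1 =
      Function.update (x + Pi.single 0 1) 0 (-(x + Pi.single 0 1 : Site 3) 0) := by
  funext i
  fin_cases i <;> simp
  ring

/-- Reflection and the unit steps: `r(x) ± eᵢ = r(x ± eᵢ)` for `i ≠ 0`. [folklore] -/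
theorem reflect_add_single_ne (x : Site 3) {i : Fin 3} (hi : i ≠ 0) (c : ℤ) :
    Function.update x 0 (-x 0) + Pi.single i c =
      Function.update (x + Pi.single i c) 0 (-(x + Pi.single i c : Site 3) 0) := by
  funext j
  by_cases hj : j = 0
  · subst hj
    simp [hi.symm]
  · simp [Function.update_of_ne hj, Pi.add_apply]

/-- The neighbour sum `∑ᵢ (G(x+eᵢ) + G(x−eᵢ))` is invariant under the reflection `x₀ ↦ −x₀`
(the two `e₀`-neighbours are swapped, the others reflected). [folklore] -/
theorem nbrSum_reflect (x : Site 3) :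
    ∑ i : Fin 3, (criticalTwoPoint 3 (Function.update x 0 (-x 0) + Pi.single i 1) +
        criticalTwoPoint 3 (Function.update x 0 (-x 0) - Pi.single i 1)) =
      ∑ i : Fin 3, (criticalTwoPoint 3 (x + Pi.single i 1) + criticalTwoPoint 3 (x - Pi.single i 1)) := by
  refine Finset.sum_congr rfl fun i _ => ?_
  by_cases hi : i = 0
  · subst hi
    rw [reflect_add_single_zero, reflect_sub_single_zero, criticalTwoPoint_reflect,
      criticalTwoPoint_reflect, add_comm]
  · have h1 := reflect_add_single_ne x hi 1
    have h2 := reflect_add_single_ne x hi (-1)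
    have hneg : (Pi.single i (-1 : ℤ) : Site 3) = -Pi.single i 1 := by
      rw [← Pi.single_neg]
    rw [hneg, ← sub_eq_add_neg, ← sub_eq_add_neg] at h2
    rw [h1, h2, criticalTwoPoint_reflect, criticalTwoPoint_reflect]

/-! ### Antitone sequences along the first axis -/

/-- The lattice point `x + k e₀` with `x₀ ≥ 0` in the coordinates used by
`AxisBalance.tendsto_nbrSum_div_shiftedAxis`. [folklore] -/
theorem add_nsmul_single_eq (x : Site 3) (hx0 : 0 ≤ x 0) (k : ℕ) :
    x + Pi.single 0 (k : ℤ) = (![(((x 0).toNat + k : ℕ) : ℤ), x 1, x 2] : Site 3) := by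
  have h0 : (((x 0).toNat : ℕ) : ℤ) = x 0 := Int.toNat_of_nonneg hx0
  funext i
  fin_cases i
  · simp [h0]
  · simp
  · simp

/-- **Census S1 ⇒ SubH.** If the neighbour-sum ratio `R(x) = ∑_{y∼x}G(y)/G(x)` of the critical
two-point function of `ℤ³` is non-increasing under the outward move `x ↦ x + e₀` at every `x ≠ 0`
with `x₀ ≥ 0`, then `SubharmonicOffOrigin` holds.  Proof: along `k ↦ x + k e₀` the ratio is
non-increasing and tends to `6` (`tendsto_nbrSum_div_shiftedAxis`), so `R(x) ≥ 6`; sites with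
`x₀ < 0` are reflected. [folklore] -/
theorem subharmonicOffOrigin_of_ratioAntitone
    (hmono : ∀ x : Site 3, x ≠ 0 → 0 ≤ x 0 →
      (∑ i : Fin 3, (criticalTwoPoint 3 (x + Pi.single 0 1 + Pi.single i 1) +
          criticalTwoPoint 3 (x + Pi.single 0 1 - Pi.single i 1))) /
          criticalTwoPoint 3 (x + Pi.single 0 1) ≤
        (∑ i : Fin 3, (criticalTwoPoint 3 (x + Pi.single i 1) +
          criticalTwoPoint 3 (x - Pi.single i 1))) / criticalTwoPoint 3 x) :
    SubharmonicOffOrigin := by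
  have hβc : 0 < criticalBeta 3 := criticalBeta_pos_holds (d := 3) (by norm_num)
  have hGpos : ∀ y : Site 3, 0 < criticalTwoPoint 3 y := fun y => twoPointPlus_pos hβc y
  -- Step 1: the half-space `x₀ ≥ 0`
  have hhalf : ∀ x : Site 3, x ≠ 0 → 0 ≤ x 0 →
      6 * criticalTwoPoint 3 x ≤
        ∑ i : Fin 3, (criticalTwoPoint 3 (x + Pi.single i 1) + criticalTwoPoint 3 (x - Pi.single i 1)) := by
    intro x hx hx0
    -- the sequence of ratios along `x + k e₀`
    set f : ℕ → ℝ := fun k =>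
      (∑ i : Fin 3, (criticalTwoPoint 3 (x + Pi.single 0 (k : ℤ) + Pi.single i 1) +
          criticalTwoPoint 3 (x + Pi.single 0 (k : ℤ) - Pi.single i 1))) /
        criticalTwoPoint 3 (x + Pi.single 0 (k : ℤ)) with hf
    have hne : ∀ k : ℕ, x + Pi.single 0 (k : ℤ) ≠ 0 := by
      intro k h
      have h0 := congrFun h 0
      simp only [Pi.add_apply, Pi.single_eq_same, Pi.zero_apply] at h0
      have hk : (k : ℤ) = 0 := by omega
      have hx00 : x 0 = 0 := by omega
      apply hx
      funext i
      have hi := congrFun h i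
      fin_cases i
      · simpa using hx00
      · simpa using hi
      · simpa using hi
    have hanti : Antitone f := by
      refine antitone_nat_of_succ_le fun k => ?_
      have hk0 : 0 ≤ (x + Pi.single 0 (k : ℤ) : Site 3) 0 := by
        simp only [Pi.add_apply, Pi.single_eq_same]; omega
      have h := hmono (x + Pi.single 0 (k : ℤ)) (hne k) hk0
      have hstep : x + Pi.single 0 (k : ℤ) + Pi.single 0 1 = x + Pi.single 0 ((k + 1 : ℕ) : ℤ) := by
        rw [add_assoc, ← Pi.single_add]
        push_cast
        rfl
      simp only [hf]
      rw [← hstep]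
      exact h
    have hlim : Tendsto f atTop (𝓝 6) := by
      have h := tendsto_nbrSum_div_shiftedAxis (x 1) (x 2)
      have hidx : Tendsto (fun k : ℕ => (x 0).toNat + k) atTop atTop :=
        tendsto_atTop_atTop.2 fun b => ⟨b, fun k hk => le_trans hk (Nat.le_add_left k _)⟩
      have h2 := h.comp hidx
      refine h2.congr fun k => ?_
      simp only [Function.comp, hf]
      rw [add_nsmul_single_eq x hx0 k]
    have h6 : (6 : ℝ) ≤ f 0 := hanti.le_of_tendsto hlim 0
    have hf0 : f 0 = (∑ i : Fin 3, (criticalTwoPoint 3 (x + Pi.single i 1) +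
        criticalTwoPoint 3 (x - Pi.single i 1))) / criticalTwoPoint 3 x := by
      simp [hf]
    rw [hf0, le_div_iff₀ (hGpos x)] at h6
    exact h6
  -- Step 2: the other half-space by reflection
  intro x hx
  by_cases hx0 : 0 ≤ x 0
  · exact hhalf x hx hx0
  · push Not at hx0
    set x' : Site 3 := Function.update x 0 (-x 0) with hx'
    have hx'0 : 0 ≤ x' 0 := by
      simp only [hx', Function.update_self]; omega
    have hx'ne : x' ≠ 0 := by
      intro h
      have h0 := congrFun h 0
      simp only [hx', Function.update_self, Pi.zero_apply] at h0
      omega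
    have h := hhalf x' hx'ne hx'0
    rw [hx', nbrSum_reflect, criticalTwoPoint_reflect] at h
    exact h

/-- One-line form (registered sub-goal of stmt-CriticalPhenomena-1341): outward ratio
monotonicity along the first axis on the half-space `x₀ ≥ 0` (census S1, weakest useful form)
implies the crux `SubharmonicOffOrigin`. [folklore] -/
theorem subharmonicOffOrigin_of_ratioAntitone' : (∀ x : Site 3, x ≠ 0 → 0 ≤ x 0 → (∑ i : Fin 3, (criticalTwoPoint 3 (x + Pi.single 0 1 + Pi.single i 1) + criticalTwoPoint 3 (x + Pi.single 0 1 - Pi.single i 1))) / criticalTwoPoint 3 (x + Pi.single 0 1) ≤ (∑ i : Fin 3, (criticalTwoPoint 3 (x + Pi.single i 1) + criticalTwoPoint 3 (x - Pi.single i 1))) / criticalTwoPoint 3 x) → SubharmonicOffOrigin :=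
  fun h => subharmonicOffOrigin_of_ratioAntitone h

end Summit.CriticalPhenomena.Ising3DConformalLimit.Theorems.PerfectScreening.RatioMonotone
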